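import Literature.AlgebraicGeometry.HodgeTheory.HypersurfaceComplexPoints
import Literature.AlgebraicGeometry.Motives.ComplexPointsManifold
import Mathlib.Analysis.Calculus.FDeriv.Comp
import Mathlib.Analysis.Calculus.FDeriv.Mul
import Mathlib.Analysis.Calculus.FDeriv.Pi
import HarnessLib

/-!
# The analytification of an embedded smooth variety is immersed in `ℙⁿ(ℂ)`: the affine coordinates have injective differential in every algebraic chart

Family `hodge`, layer `Literature/AlgebraicGeometry/HodgeTheory`.  A brick of the Morse-theoretic
input (Andreotti–Frankel 1959; C. Voisin, *Hodge Theory and Complex Algebraic Geometry II* (2003),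
§1.2.1–1.2.2, Prop. 1.19 and Thm. 1.22) still missing for the named fact
`BFNP2009_vanishingCohomology_nontrivial` (Brosnan–Fang–Nie–Pearlstein 2009, Prop. 43): the
reduction `BFNP2009_vanishingCohomology_nontrivial.of_andreottiFrankel_of_eulerChar`
(`VanishingCohomologyNontrivialProofs`) asks for `H_j((X ∖ Y)(ℂ); ℂ) = 0`, `j > dim X`, for the
complement of a hypersurface section of a smooth projective `X ↪ ℙᴺ`, and the printed proof
(Voisin II, proof of Thm. 1.22 with Prop. 1.19) runs Morse theory for the squared distance of an
affine embedding of the smooth affine variety `X ∖ Y`, whose Hessian at a critical point is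
`2(‖du‖² + Re H)` with `‖du‖²` POSITIVE DEFINITE because the embedding is an IMMERSION
(`ComplexHessianIndex.sigNeg_le_finrank_complex_of_re_bilin` records the linear algebra).  The
immersion property of `X(ℂ) → ℙᴺ(ℂ)` for a smooth embedded `X` is Serre's «au voisinage d'un point
simple, `Xʰ` est une sous-variété analytique» (GAGA §2 n°6, with §1 n°4); it is proved here on the
tree's carriers, for any closed immersion `ι : Y ↪ ℙ^{n+1}_ℂ` and any *holomorphic algebraic chart*
`c` of `Y(ℂ)` (the charts of `Literature.NumberTheory.Transcendental.exists_algebraicChart`, whose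
existence at every point of a smooth `Y` is the tree's PROVED `exists_algebraicChart_holds`, and
which form the atlas of the analytification, `exists_isAnalytification_of_exists_algebraicChart`):

* `affineCoordsInChart ι c i : ℂᵐ → ℂ^{n+1}`, `w ↦` the affine coordinates, in the `i`-th standard
  chart of `ℙ ℂ ℂ^{n+2}` (`Projectivization.stdChart`), of the point `ψ(c⁻¹ w)`,
  `ψ = hypersurfacePoint ι : Y(ℂ) → ℙ ℂ ℂ^{n+2}` the homogeneous-coordinate map of
  `HypersurfaceComplexPoints`;
* `eval_app_eq_evalOrZero_projPoint` — a regular function `G` on `Uᵢ ⊆ ℙ^{n+1}` restricted to `Y`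
  takes at `Q` the value of `G` at `ψ(Q)`, read through the chart (`AlgPoints.eval_map`);
* `contDiffOn_affineCoordsInChart` — the affine coordinates are holomorphic (`C^ω`) in the chart,
  on the open set `affineCoordsDomain ι c i` of parameters `w` with `ψ(c⁻¹ w) ∈ Uᵢ` (their
  components are the regular functions `ι^*(X_k/Xᵢ)`, `evalOrZero_hypersurfaceCoordFn`);
* `injective_fderiv_affineCoordsInChart` — **the differential of the affine coordinates is
  injective** at every such `w₀`.  Proof (Serre, GAGA §2 n°5 Lemme 1 c) run backwards): each
  coordinate `x_t` of the chart is a regular function, hence near `P = c⁻¹ w₀` a fraction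
  `g_t / f_t^{n_t}` of regular functions on the affine open `ι⁻¹(Uᵢ)` (`AlgPoints.exists_fraction`),
  which lift along the closed immersion to regular functions `G_t, F_t` on `Uᵢ`
  (`Scheme.Hom.app_surjective`), themselves holomorphic functions `γ_t, φ_t` of the affine
  coordinates (`differentiableAt_evalOrZero_projPoint_stdChartInv`); so
  `w = R(A(w))` near `w₀` with `R = (γ_t/φ_t^{n_t})_t` holomorphic at `A(w₀)` and
  `A = affineCoordsInChart ι c i`, whence `DR ∘ DA(w₀) = id` and `DA(w₀)` is injective.

Everything here is proved; no definitions beyond the two abbreviations above, no named facts.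

## References

* [SerreGAGA1956] J.-P. Serre, Géométrie algébrique et géométrie analytique, Ann. Inst. Fourier 6
  (1956), §1 n°4, §2 n°5 Lemme 1 c) and Prop. 2, n°6 Prop. 3 Cor. 2.
* [VoisinHodgeII2003] C. Voisin, Hodge Theory and Complex Algebraic Geometry II (CUP 2003), §1.2.1
  Prop. 1.19, §1.2.2 Thm. 1.22 (proof).
* [BrosnanFangNiePearlstein2009] P. Brosnan, H. Fang, Z. Nie, G. Pearlstein, Singularities of
  admissible normal functions, Invent. Math. 177 (2009), §5 Prop. 43.
-/

noncomputable section

open scoped Topology LinearAlgebra.Projectivization ContDiff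
open Set AlgebraicGeometry CategoryTheory Topology Filter
open Literature.NumberTheory.Transcendental Literature.AlgebraicGeometry.Motives

namespace Literature.AlgebraicGeometry.HodgeTheory

attribute [local instance] MvPolynomial.gradedAlgebra

variable {n m : ℕ} {Y : SchemeOver ℂ} (ι : Y ⟶ projectiveSpace (n + 1) ℂ)

/-! ### The affine coordinates of `ψ(c⁻¹ w)` -/

/-- **The affine coordinates of the embedded scheme in a chart of `Y(ℂ)`**: for a chart `c` of
`Y(ℂ)` valued in `ℂᵐ` and the `i`-th standard chart of `ℙ ℂ ℂ^{n+2}`, the map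
`w ↦ (z_{i.succAbove j}/zᵢ)_j` of the point `ψ(c⁻¹ w)`, `ψ = hypersurfacePoint ι`.
[cite: SerreGAGA1956, §2 n°5 Prop. 2] -/
def affineCoordsInChart (c : OpenPartialHomeomorph (ComplexPoints Y) (Fin m → ℂ))
    (i : Fin (n + 2)) : (Fin m → ℂ) → (Fin (n + 1) → ℂ) :=
  fun w ↦ Projectivization.stdChart i (hypersurfacePoint ι (c.symm w))

/-- The open set of parameters `w ∈ c.target` with `ψ(c⁻¹ w) ∈ Uᵢ = {zᵢ ≠ 0}`. [folklore] -/
def affineCoordsDomain (c : OpenPartialHomeomorph (ComplexPoints Y) (Fin m → ℂ))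
    (i : Fin (n + 2)) : Set (Fin m → ℂ) :=
  c.target ∩ c.symm ⁻¹' (hypersurfacePoint ι ⁻¹' Projectivization.stdChartSource i)

variable (c : OpenPartialHomeomorph (ComplexPoints Y) (Fin m → ℂ)) (i : Fin (n + 2))

/-- Unfolding `affineCoordsInChart`. [folklore] -/
theorem affineCoordsInChart_apply (w : Fin m → ℂ) :
    affineCoordsInChart ι c i w =
      Projectivization.stdChartFun i (hypersurfacePoint ι (c.symm w)) :=
  rfl

/-- Membership in `affineCoordsDomain`. [folklore] -/
theorem mem_affineCoordsDomain_iff (w : Fin m → ℂ) :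
    w ∈ affineCoordsDomain ι c i ↔
      w ∈ c.target ∧ hypersurfacePoint ι (c.symm w) ∈ Projectivization.stdChartSource i :=
  Iff.rfl

/-- `affineCoordsDomain ι c i` is open (`c⁻¹` is continuous on `c.target`, `ψ` is continuous and
`Uᵢ` is open). [folklore] -/
theorem isOpen_affineCoordsDomain : IsOpen (affineCoordsDomain ι c i) :=
  c.continuousOn_symm.isOpen_inter_preimage c.open_target
    ((Projectivization.isOpen_stdChartSource i).preimage (continuous_hypersurfacePoint ι))

/-! ### Regular functions of the ambient chart, restricted to `Y`, as functions of the affine coordinates -/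

section Ambient

variable [IsClosedImmersion ι.left]

/-- A complex point `Q` of `Y` with `ψ(Q) ∈ Uᵢ` lies over the affine open `ι⁻¹(Uᵢ)`. [folklore] -/
theorem pt_mem_preimage_projChartOpen {Q : ComplexPoints Y}
    (hQ : hypersurfacePoint ι Q ∈ Projectivization.stdChartSource i) :
    Q.pt ∈ ι.left ⁻¹ᵁ projChartOpen i :=
  (mem_hypersurfaceAffineChart_iff ι i Q).mpr (by rwa [Projectivization.stdChart_source])

omit [IsClosedImmersion ι.left] in
/-- **Restricted ambient functions are functions of the affine coordinates.** For a regular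
function `G` on `Uᵢ ⊆ ℙ^{n+1}_ℂ` and a complex point `Q` of `Y` with `ψ(Q) ∈ Uᵢ`, the value at `Q` of
`ι^* G` is the value of `G` at the point of `ℙ^{n+1}_ℂ(ℂ)` with affine coordinates those of `ψ(Q)`
(naturality of evaluation, `AlgPoints.eval_map`; `ψ(Q)` corresponds to `ι(Q)` under Serre's
comparison `projPoint`). [cite: SerreGAGA1956, §2 n°5 Lemme 1 c)] -/
theorem eval_app_eq_evalOrZero_projPoint (G : Γ((projectiveSpace (n + 1) ℂ).left, projChartOpen i))
    {Q : ComplexPoints Y} (hQ : hypersurfacePoint ι Q ∈ Projectivization.stdChartSource i)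
    (h : Q.pt ∈ ι.left ⁻¹ᵁ projChartOpen i) :
    Q.eval (ι.left ⁻¹ᵁ projChartOpen i) h (ι.left.app (projChartOpen i) G) =
      AlgPoints.evalOrZero (projChartOpen i) G (projPoint (n + 1)
        (Projectivization.stdChartInv i
          (Projectivization.stdChartFun i (hypersurfacePoint ι Q)))) := by
  rw [Projectivization.stdChartInv_stdChartFun i hQ, projPoint_hypersurfacePoint,
    AlgPoints.evalOrZero_of_mem _ (show (AlgPoints.map ι Q).pt ∈ projChartOpen i from h),
    AlgPoints.eval_map]

/-- The value of `ι^* G` at `Q` is non-zero iff `Q` lies over the basic open `D(ι^* G)`.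
[folklore] -/
theorem evalOrZero_projPoint_ne_zero_iff (G : Γ((projectiveSpace (n + 1) ℂ).left, projChartOpen i))
    {Q : ComplexPoints Y} (hQ : hypersurfacePoint ι Q ∈ Projectivization.stdChartSource i) :
    AlgPoints.evalOrZero (projChartOpen i) G (projPoint (n + 1)
        (Projectivization.stdChartInv i
          (Projectivization.stdChartFun i (hypersurfacePoint ι Q)))) ≠ 0 ↔
      Q.pt ∈ Y.left.basicOpen (ι.left.app (projChartOpen i) G) := by
  rw [← eval_app_eq_evalOrZero_projPoint ι i G hQ (pt_mem_preimage_projChartOpen ι i hQ),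
    AlgPoints.eval_ne_zero_iff_mem_basicOpen]

/-- **Ambient regular functions are holomorphic in the affine coordinates** at the coordinates of
a point of `Y` over `Uᵢ` (the tree's `differentiableAt_evalOrZero_projPoint_stdChartInv`: a regular
function on an open of `ℙⁿ_ℂ` is, in the standard chart, locally a quotient of polynomials).
[cite: SerreGAGA1956, §2 n°5 Lemme 1 c)] -/
theorem differentiableAt_evalOrZero_projPoint_affineCoords
    (G : Γ((projectiveSpace (n + 1) ℂ).left, projChartOpen i))
    {Q : ComplexPoints Y} (hQ : hypersurfacePoint ι Q ∈ Projectivization.stdChartSource i) :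
    DifferentiableAt ℂ (fun v : Fin (n + 1) → ℂ ↦
        AlgPoints.evalOrZero (projChartOpen i) G (projPoint (n + 1)
          (Projectivization.stdChartInv i v)))
      (Projectivization.stdChartFun i (hypersurfacePoint ι Q)) := by
  refine differentiableAt_evalOrZero_projPoint_stdChartInv (n + 1) (projChartOpen i) G i _ ?_
  rw [Projectivization.stdChartInv_stdChartFun i hQ, projPoint_hypersurfacePoint]
  exact pt_mem_preimage_projChartOpen ι i hQ

end Ambient

/-! ### The affine coordinates are holomorphic in an algebraic chart -/

section Holomorphic

variable [IsClosedImmersion ι.left]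
  (hol : ∀ (U : Y.left.affineOpens) (s : Γ(Y.left, ↑U)),
    ContDiffOn ℂ ω (AlgPoints.evalOrZero ↑U s ∘ c.symm) (c.target ∩ c.symm ⁻¹' {P | P.pt ∈ (↑U : Y.left.Opens)}))
include hol

/-- **The affine coordinates are holomorphic in a holomorphic algebraic chart**: if every regular
function on every affine open of `Y` is `C^ω` in the chart `c` (property (ii) of
`exists_algebraicChart`), then `w ↦ stdChartᵢ(ψ(c⁻¹ w))` is `C^ω` on `affineCoordsDomain ι c i` —
its components are the regular functions `ι^*(X_{i.succAbove j}/Xᵢ)` on the affine open `ι⁻¹(Uᵢ)`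
(`evalOrZero_hypersurfaceCoordFn`). [cite: SerreGAGA1956, §2 n°5 Lemme 1 c) and Prop. 2] -/
theorem contDiffOn_affineCoordsInChart :
    ContDiffOn ℂ ω (affineCoordsInChart ι c i) (affineCoordsDomain ι c i) := by
  have hdom : affineCoordsDomain ι c i =
      c.target ∩ c.symm ⁻¹' {P | P.pt ∈ (↑(hypersurfaceAffineChart ι i) : Y.left.Opens)} := by
    rw [affineCoordsDomain, setOf_mem_hypersurfaceAffineChart, Projectivization.stdChart_source]
  refine contDiffOn_pi.2 fun j ↦ ?_
  refine ((hol (hypersurfaceAffineChart ι i) (hypersurfaceCoordFn ι i j)).congr ?_).mono hdom.le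
  rintro w ⟨-, hw⟩
  rw [Function.comp_apply, evalOrZero_hypersurfaceCoordFn ι i j (c.symm w) hw,
    affineCoordsInChart, Projectivization.stdChart_apply]

/-- The affine coordinates are (complex) differentiable at every point of `affineCoordsDomain`.
[cite: SerreGAGA1956, §2 n°5 Prop. 2] -/
theorem differentiableAt_affineCoordsInChart {w₀ : Fin m → ℂ} (hw₀ : w₀ ∈ affineCoordsDomain ι c i) :
    DifferentiableAt ℂ (affineCoordsInChart ι c i) w₀ :=
  ((contDiffOn_affineCoordsInChart ι c i hol).differentiableOn (by simp)).differentiableAt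
    ((isOpen_affineCoordsDomain ι c i).mem_nhds hw₀)

end Holomorphic

/-! ### The differential of the affine coordinates is injective -/

section Immersion

variable [IsClosedImmersion ι.left]

/-- **The analytification of an embedded variety is immersed in `ℙ^{n+1}(ℂ)`** (Serre, GAGA §2 n°6
with §1 n°4: at a simple point `Xʰ` is an analytic submanifold; the differential form used by
Morse theory on affine varieties, Voisin II Prop. 1.19 / Thm. 1.22).  Let `ι : Y ↪ ℙ^{n+1}_ℂ` be a
closed immersion and `c` a holomorphic algebraic chart of `Y(ℂ)` valued in `ℂᵐ`: its coordinates
are regular functions `x_t` on an affine open `U` containing the points under `c.source`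
((i) of `exists_algebraicChart`), and all regular functions on affine opens are `C^ω` in `c` ((ii)).
Then at every `w₀ ∈ c.target` with `ψ(c⁻¹ w₀)` in the `i`-th standard chart, the differential of
`w ↦ stdChartᵢ(ψ(c⁻¹ w)) ∈ ℂ^{n+1}` is injective.  Proof: near `P = c⁻¹ w₀` each `x_t` is a
fraction `g_t/f_t^{n_t}` on the affine open `ι⁻¹(Uᵢ)` (`AlgPoints.exists_fraction`), `f_t, g_t`
lift to `Uᵢ` along the closed immersion (`Scheme.Hom.app_surjective`) and are there holomorphic
functions `φ_t, γ_t` of the affine coordinates; hence `w = R(A(w))` near `w₀` with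
`R = (γ_t/φ_t^{n_t})_t` holomorphic at `A(w₀)`, and `DR(A(w₀)) ∘ DA(w₀) = id`.
[cite: SerreGAGA1956, §2 n°5 Lemme 1 c), Prop. 2 and n°6 Prop. 3 Cor. 2]
[cite: VoisinHodgeII2003, §1.2.1 Prop. 1.19 (setting: `X ⊂ ℂᴺ` a complex submanifold)] -/
theorem injective_fderiv_affineCoordsInChart
    (U : Y.left.affineOpens) (x : Fin m → Γ(Y.left, ↑U))
    (hsrc : c.source ⊆ {P | P.pt ∈ (↑U : Y.left.Opens)})
    (hx : ∀ P ∈ c.source, ∀ t, c P t = AlgPoints.evalOrZero ↑U (x t) P)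
    (hol : ∀ (U' : Y.left.affineOpens) (s : Γ(Y.left, ↑U')),
      ContDiffOn ℂ ω (AlgPoints.evalOrZero ↑U' s ∘ c.symm)
        (c.target ∩ c.symm ⁻¹' {P | P.pt ∈ (↑U' : Y.left.Opens)}))
    {w₀ : Fin m → ℂ} (hw₀ : w₀ ∈ affineCoordsDomain ι c i) :
    Function.Injective (fderiv ℂ (affineCoordsInChart ι c i) w₀) := by
  classical
  obtain ⟨hw₀t, hi⟩ := hw₀
  -- the point `P = c⁻¹ w₀` and the affine open `Ua = ι⁻¹(Uᵢ)`
  set P : ComplexPoints Y := c.symm w₀ with hPdef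
  have hPsrc : P ∈ c.source := c.map_target hw₀t
  have hPU : P.pt ∈ (↑U : Y.left.Opens) := hsrc hPsrc
  set Ua : Y.left.Opens := ι.left ⁻¹ᵁ projChartOpen i with hUa
  have hUaff : IsAffineOpen Ua := (isAffineOpen_projChartOpen i).preimage ι.left
  have hPa : P.pt ∈ Ua := pt_mem_preimage_projChartOpen ι i hi
  -- Step 1: local fractions `x_t = g_t / f_t ^ n_t` on `Ua` near `P`
  choose f g nn hle hPf hfrac using fun t : Fin m ↦
    AlgPoints.exists_fraction (L := ℂ) hUaff (x t) hPa hPU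
  -- Step 2: lift `f_t, g_t` to regular functions `F_t, G_t` on `Uᵢ ⊆ ℙ^{n+1}`
  choose F hF using fun t ↦ ι.left.app_surjective (projChartOpen i) (isAffineOpen_projChartOpen i) (f t)
  choose G hG using fun t ↦ ι.left.app_surjective (projChartOpen i) (isAffineOpen_projChartOpen i) (g t)
  -- the holomorphic functions `φ_t, γ_t` of the affine coordinates and `R = (γ_t / φ_t ^ n_t)_t`
  set φ : Fin m → (Fin (n + 1) → ℂ) → ℂ := fun t v ↦
    AlgPoints.evalOrZero (projChartOpen i) (F t) (projPoint (n + 1) (Projectivization.stdChartInv i v))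
    with hφ
  set γ : Fin m → (Fin (n + 1) → ℂ) → ℂ := fun t v ↦
    AlgPoints.evalOrZero (projChartOpen i) (G t) (projPoint (n + 1) (Projectivization.stdChartInv i v))
    with hγ
  set R : (Fin (n + 1) → ℂ) → (Fin m → ℂ) := fun v t ↦ γ t v / φ t v ^ nn t with hR
  set A := affineCoordsInChart ι c i with hA
  have hAw₀ : A w₀ = Projectivization.stdChartFun i (hypersurfacePoint ι P) := rfl
  -- values of `φ_t, γ_t` at the coordinates of a point `Q` of `Y` over `Uᵢ`
  have hφval : ∀ t {Q : ComplexPoints Y} (hQ : hypersurfacePoint ι Q ∈ Projectivization.stdChartSource i)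
      (h : Q.pt ∈ Ua), φ t (Projectivization.stdChartFun i (hypersurfacePoint ι Q)) = Q.eval Ua h (f t) := by
    intro t Q hQ h
    rw [hφ]; dsimp only
    rw [← eval_app_eq_evalOrZero_projPoint ι i (F t) hQ h, hF]
  have hγval : ∀ t {Q : ComplexPoints Y} (hQ : hypersurfacePoint ι Q ∈ Projectivization.stdChartSource i)
      (h : Q.pt ∈ Ua), γ t (Projectivization.stdChartFun i (hypersurfacePoint ι Q)) = Q.eval Ua h (g t) := by
    intro t Q hQ h
    rw [hγ]; dsimp only
    rw [← eval_app_eq_evalOrZero_projPoint ι i (G t) hQ h, hG]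
  -- `φ_t (A w₀) ≠ 0` since `P ∈ D(f_t)`
  have hφ0 : ∀ t, φ t (A w₀) ≠ 0 := fun t ↦ by
    rw [hAw₀, hφval t hi hPa, AlgPoints.eval_ne_zero_iff_mem_basicOpen]
    exact hPf t
  -- Step 3: `R` is differentiable at `A w₀`
  have hRd : DifferentiableAt ℂ R (A w₀) := by
    refine differentiableAt_pi.2 fun t ↦ ?_
    have h1 : DifferentiableAt ℂ (γ t) (A w₀) := by
      rw [hAw₀]; exact differentiableAt_evalOrZero_projPoint_affineCoords ι i (G t) hi
    have h2 : DifferentiableAt ℂ (φ t) (A w₀) := by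
      rw [hAw₀]; exact differentiableAt_evalOrZero_projPoint_affineCoords ι i (F t) hi
    change DifferentiableAt ℂ (fun v ↦ γ t v / φ t v ^ nn t) (A w₀)
    simp only [div_eq_mul_inv]
    exact h1.mul ((h2.pow _).inv (pow_ne_zero _ (hφ0 t)))
  -- Step 4: `A` is differentiable at `w₀`
  have hAd : DifferentiableAt ℂ A w₀ :=
    differentiableAt_affineCoordsInChart ι c i hol ⟨hw₀t, hi⟩
  -- Step 5: `R ∘ A = id` near `w₀`
  have hV : IsOpen {Q : ComplexPoints Y | hypersurfacePoint ι Q ∈ Projectivization.stdChartSource i ∧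
      ∀ t, Q.pt ∈ Y.left.basicOpen (f t)} := by
    have h1 : IsOpen {Q : ComplexPoints Y | hypersurfacePoint ι Q ∈ Projectivization.stdChartSource i} :=
      (Projectivization.isOpen_stdChartSource i).preimage (continuous_hypersurfacePoint ι)
    have h2 : IsOpen {Q : ComplexPoints Y | ∀ t, Q.pt ∈ Y.left.basicOpen (f t)} := by
      rw [Set.setOf_forall]
      exact isOpen_iInter_of_finite fun t ↦ AlgPoints.isOpen_setOf_pt_mem _
    exact h1.inter h2
  have hS : IsOpen (c.target ∩ c.symm ⁻¹' {Q : ComplexPoints Y |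
      hypersurfacePoint ι Q ∈ Projectivization.stdChartSource i ∧ ∀ t, Q.pt ∈ Y.left.basicOpen (f t)}) :=
    c.continuousOn_symm.isOpen_inter_preimage c.open_target hV
  have hw₀S : w₀ ∈ c.target ∩ c.symm ⁻¹' {Q : ComplexPoints Y |
      hypersurfacePoint ι Q ∈ Projectivization.stdChartSource i ∧ ∀ t, Q.pt ∈ Y.left.basicOpen (f t)} :=
    ⟨hw₀t, hi, hPf⟩
  have hRA : (fun w ↦ R (A w)) =ᶠ[𝓝 w₀] id := by
    refine Filter.eventuallyEq_of_mem (hS.mem_nhds hw₀S) ?_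
    rintro w ⟨hwt, hwi, hwf⟩
    set Q : ComplexPoints Y := c.symm w with hQdef
    have hQsrc : Q ∈ c.source := c.map_target hwt
    have hQU : Q.pt ∈ (↑U : Y.left.Opens) := hsrc hQsrc
    have hQa : Q.pt ∈ Ua := pt_mem_preimage_projChartOpen ι i hwi
    change R (A w) = w
    funext t
    -- `w t = x_t (Q)`
    have hwt' : w t = Q.eval ↑U hQU (x t) := by
      have h1 : c Q t = AlgPoints.evalOrZero ↑U (x t) Q := hx Q hQsrc t
      have h2 : c Q = w := c.right_inv hwt
      rw [h2] at h1
      rw [h1]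
      exact AlgPoints.evalOrZero_of_mem _ hQU
    -- the fraction identity at `Q`
    have hf0 : Q.eval Ua hQa (f t) ≠ 0 :=
      (AlgPoints.eval_ne_zero_iff_mem_basicOpen Q Ua hQa (f t)).mpr (hwf t)
    have key := hfrac t Q (hwf t)
    have hAw : A w = Projectivization.stdChartFun i (hypersurfacePoint ι Q) := rfl
    change γ t (A w) / φ t (A w) ^ nn t = w t
    rw [hAw, hγval t hwi hQa, hφval t hwi hQa, hwt', div_eq_iff (pow_ne_zero _ hf0)]
    exact key.symm
  -- Step 6: differentiate `R ∘ A = id`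
  have hcomp : (fderiv ℂ R (A w₀)).comp (fderiv ℂ A w₀) = ContinuousLinearMap.id ℂ (Fin m → ℂ) := by
    have h1 : fderiv ℂ (R ∘ A) w₀ = (fderiv ℂ R (A w₀)).comp (fderiv ℂ A w₀) :=
      fderiv_comp w₀ hRd hAd
    have h2 : fderiv ℂ (R ∘ A) w₀ = fderiv ℂ id w₀ := hRA.fderiv_eq
    rw [← h1, h2, fderiv_id]
  intro u v huv
  have := congrArg (fderiv ℂ R (A w₀)) huv
  rw [← ContinuousLinearMap.comp_apply, ← ContinuousLinearMap.comp_apply, hcomp] at this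
  simpa using this

/-- The affine coordinates are injective on `affineCoordsDomain ι c i` (`c⁻¹` is injective on
`c.target`, `ψ` is injective for a closed immersion, and the standard chart is injective on `Uᵢ`):
together with `injective_fderiv_affineCoordsInChart`, the chart-level statement that `Y(ℂ) → ℙ^{n+1}(ℂ)`
is an injective immersion. [cite: SerreGAGA1956, §2 n°5 Lemme 1 b) and Prop. 2] -/
theorem injOn_affineCoordsInChart : InjOn (affineCoordsInChart ι c i) (affineCoordsDomain ι c i) := by
  rintro w ⟨hwt, hwi⟩ w' ⟨hw't, hw'i⟩ h
  have h1 : hypersurfacePoint ι (c.symm w) = hypersurfacePoint ι (c.symm w') :=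
    (Projectivization.stdChart i).injOn (by rwa [Projectivization.stdChart_source])
      (by rwa [Projectivization.stdChart_source]) h
  have h2 : c.symm w = c.symm w' := (isEmbedding_hypersurfacePoint ι).injective h1
  exact c.symm.injOn hwt hw't h2

end Immersion

/-! ### The canonical algebraic atlas of a smooth `Y` -/

section AlgebraicChart

variable [IsClosedImmersion ι.left] [LocallyOfFiniteType Y.hom] [SmoothOfRelativeDimension m Y.hom]

/-- In the canonical algebraic chart of the smooth scheme `Y` at `P` (`ComplexPoints.algebraicChart`,
a choice from the tree's PROVED `exists_algebraicChart_holds`), the affine coordinates of the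
embedding are `C^ω`. [cite: SerreGAGA1956, §2 n°5 Prop. 2] -/
theorem contDiffOn_affineCoordsInChart_algebraicChart (P : ComplexPoints Y) (i : Fin (n + 2)) :
    ContDiffOn ℂ ω (affineCoordsInChart ι (ComplexPoints.algebraicChart Y m P) i)
      (affineCoordsDomain ι (ComplexPoints.algebraicChart Y m P) i) :=
  contDiffOn_affineCoordsInChart ι _ i (exists_algebraicChart_holds Y m P).choose_spec.2.2

/-- **`Y(ℂ) → ℙ^{n+1}(ℂ)` is an immersion for `Y` smooth**, in the canonical algebraic atlas: for `Y`
smooth of relative dimension `m` and locally of finite type over `ℂ` and a closed immersion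
`ι : Y ↪ ℙ^{n+1}_ℂ`, the affine coordinates of `ψ = hypersurfacePoint ι` read in the algebraic chart
at any `P` have injective differential wherever they are defined (Serre, GAGA §2 n°6: `Yʰ` is an
`m`-dimensional analytic submanifold of `ℙ^{n+1}(ℂ)` near each simple point).
[cite: SerreGAGA1956, §2 n°6 Prop. 3 Cor. 2, with §1 n°4 and n°5 Prop. 2] -/
theorem injective_fderiv_affineCoordsInChart_algebraicChart (P : ComplexPoints Y) (i : Fin (n + 2))
    {w₀ : Fin m → ℂ} (hw₀ : w₀ ∈ affineCoordsDomain ι (ComplexPoints.algebraicChart Y m P) i) :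
    Function.Injective (fderiv ℂ (affineCoordsInChart ι (ComplexPoints.algebraicChart Y m P) i) w₀) := by
  obtain ⟨U, x, hsrc, hx⟩ := (exists_algebraicChart_holds Y m P).choose_spec.2.1
  exact injective_fderiv_affineCoordsInChart ι _ i U x hsrc hx
    (exists_algebraicChart_holds Y m P).choose_spec.2.2 hw₀

omit [IsClosedImmersion ι.left] in
/-- Every complex point `P` of `Y` lies in the domain of the affine coordinates of its own algebraic
chart, for the standard chart `Uᵢ ∋ ψ(P)`: `(algebraicChart P) P ∈ affineCoordsDomain`. [folklore] -/
theorem apply_mem_affineCoordsDomain_algebraicChart (P : ComplexPoints Y) {i : Fin (n + 2)}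
    (hi : hypersurfacePoint ι P ∈ Projectivization.stdChartSource i) :
    ComplexPoints.algebraicChart Y m P P ∈ affineCoordsDomain ι (ComplexPoints.algebraicChart Y m P) i := by
  refine ⟨(ComplexPoints.algebraicChart Y m P).map_source (ComplexPoints.mem_algebraicChart_source Y m P), ?_⟩
  change hypersurfacePoint ι ((ComplexPoints.algebraicChart Y m P).symm
    (ComplexPoints.algebraicChart Y m P P)) ∈ Projectivization.stdChartSource i
  rwa [(ComplexPoints.algebraicChart Y m P).left_inv (ComplexPoints.mem_algebraicChart_source Y m P)]

omit [IsClosedImmersion ι.left] [LocallyOfFiniteType Y.hom] [SmoothOfRelativeDimension m Y.hom] in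
/-- Every point of `ℙ ℂ ℂ^{n+2}` lies in some standard chart; in particular so does `ψ(P)`. [folklore] -/
theorem exists_hypersurfacePoint_mem_stdChartSource (P : ComplexPoints Y) :
    ∃ i : Fin (n + 2), hypersurfacePoint ι P ∈ Projectivization.stdChartSource i :=
  Projectivization.exists_rep_apply_ne_zero _

end AlgebraicChart

end Literature.AlgebraicGeometry.HodgeTheory
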